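import Summits.BirchSwinnertonDyer.Rank1Residual.P2.CongruentNumberSilentEvenFiveThetaDescentRank
import Summits.BirchSwinnertonDyer.Rank1Residual.P2.CongruentNumberSilentEvenFiveThetaCMDisplay
import Summits.BirchSwinnertonDyer.Rank1Residual.P2.CongruentNumberEvenFiveFamilyMonskyEven
import Literature.NumberTheory.QuadraticFields.RedeiReichardtTwoPQ
import HarnessLib

/-!
# Cell «bsd-monsky» (prover-B): the genus parity on `𝒮⁻` WITHOUT the Rédei–Reichardt binder —
# `g(2pq)` odd is a KERNEL THEOREM; route B's C-P2-1 doors from {`thetaGenusPointDatum`, `hMe` | `#Sel₂ ≤ 8`},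
# clause (a) on `𝒮⁻` from the `θ`-display ALONE

HONEST FRAMING (cell `bsd-monsky`, run/shared/lean/pub/bsd-monsky/; README §1: ONE theorem on ONE explicit
infinite family of quadratic twists of the congruent number curve at the prime `2`; not "BSD for rank ≤ 1",
nothing at odd primes, nothing booked until the cross-family referee passes the written proof). Every door
here is CONDITIONAL on named hypotheses; the two conjecture `Prop`s of C-P2-1 stay `@[conjecture]`.

WHAT THIS FILE ADDS. Route B (PROOF-B, Theorem B: `g(2pq)` odd ⟹ `𝓛(2pq)` odd) needs the genus parity
«`g(2pq) = #2Cl(ℚ(√−2pq))` is ODD on `𝒮⁻`» (PROOF-B Lemma 2 / Lemma R). So far the tree decided it by Rédei's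
`3 × 3` matrix MODULO the named fact `redeiReichardt_fourTwoCard_classGroup` (`hR`, Li–Ma 2008 Thm. 0.4):
`P2.odd_genusClassNumber_genusField_two_mul_five_mul_iff (hR)`. The Literature theorem
`RedeiReichardt.fourTwoCard_classGroup_eq_one_of_sqrt_neg_two_mul_primes` (theorem-only file
`QuadraticFields/RedeiReichardtTwoPQ.lean`) now PROVES the needed special case outright — Gauss's count
`#Cl[2] = 2^{t−1} = 4` (`Quadratic.card_sq_eq_one_classGroup`) plus the two genus characters `ψ_p`, `ψ_q` on the
ramified classes `[𝔭₂], [𝔭_p], [𝔭_q]` (`(2/p) = −1`, `(q/p) = (p/q)`, `(2/q)`), which separate `Cl[2]` and kill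
only `1` when `(p/q) = −1` or `q ≡ 3 (mod 8)`. Hence:

* §1 `odd_gK_two_mul_five_mul`: for primes `p ≡ 5 (mod 8)`, `q ≡ 3 (mod 4)` with `(p/q) = −1` OR `q ≡ 3 (mod 8)`,
  `g(2pq)` is odd — UNCONDITIONAL (no `hR`); on `𝒮⁻`: `odd_gK_two_mul_five_mul_of_jacobiSym_neg`;
* §2 route B's `𝒮⁻` doors of `P2/CongruentNumberSilentEvenFiveThetaDescentRank.lean` §6 with the binder `hR`
  REMOVED: clause (a) `ord_{s=1} L(E_{2pq}, s) = 1` on all of `𝒮⁻` from the display ALONE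
  (`analyticRank_eq_one_sMinus_of_thetaDisplay (hΘ)`); «`𝓛(2pq)` odd on `𝒮⁻`» and C-P2-1 in BOTH forms from
  {`hΘ`, `hSel`} (`…_of_thetaDisplay_of_selmer_le_eight`) and from {`hΘ`, `hMe`} (`…_of_thetaDisplay_of_monskyEven`).

ROUTE B'S FACT SET for C-P2-1 (observable form `ord_{s=1} L(E_{2pq}, s) = 1 ∧ BSD(E_{2pq}, 2)` on `𝒮⁻`) is now
{`thetaGenusPointDatum` (= `thetaCMDatum`, (D1)–(D7)), `hMe`} or {`thetaGenusPointDatum`, `hSel`}: TWO named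
inputs, no Rédei–Reichardt, no GZK binder, no Monsky 1990 binder (honest framing of "no GZK binder" as in the
Rank file: the displayed TYZ Thm 3.5 is proved in print with Gross–Zagier + Kolyvagin). Nothing booked; no
mark moved.

References: HOME/proof/PROOF-B.md (v1.3) §5 (Lemma 2), §8–§10; [Cox2013] §3.B Prop. 3.11, Thm. 3.15;
[Stevenhagen1995RedeiMatrices] §2; [LiMa2008] Thm. 0.4; [TianYuanZhang2017] §1 (`g(d)`), Thm. 3.5, (1.1);
[HeathBrown1994SelmerCongruentII] Appendix (Monsky) p. 41; [Miller2011LMS] Def. 1.1; [SilvermanAEC2009] Thm. X.4.2.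
-/

noncomputable section

open scoped Classical

open WeierstrassCurve WeierstrassCurve.Affine NumberField Literature.NumberTheory.EllipticCurves
  Literature.NumberTheory.EllipticCurves.Rank1Residual
  Literature.NumberTheory.EllipticCurves.Rank1Residual.Typed
  Literature.NumberTheory.EllipticCurves.Monsky1990
  Literature.NumberTheory.EllipticCurves.HeathBrown1994
  Literature.NumberTheory.EllipticCurves.TianYuanZhang2017
  Literature.NumberTheory.EllipticCurves.TianYuanZhang2017.W2
  Literature.NumberTheory.QuadraticFields.RedeiReichardt

set_option autoImplicit false

namespace Summit.BirchSwinnertonDyer.Rank1Residual.P2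

open ThetaDescent Conjectures

/-! ## §1 The genus parity, unconditional -/

/-- **`g(2pq) = #2Cl(ℚ(√−2pq))` is ODD — UNCONDITIONAL** for primes `p ≡ 5 (mod 8)`, `q ≡ 3 (mod 4)` with
`(p/q) = −1` or `q ≡ 3 (mod 8)`: `#(2Cl ∩ Cl[2]) = 1` by the proved Rédei–Reichardt special case
(`fourTwoCard_classGroup_eq_one_of_sqrt_neg_two_mul_primes`: Gauss's `#Cl[2] = 4` + genus characters `ψ_p, ψ_q`)
for the concrete field `GenusField (2pq) = ℚ[X]/(X² + 2pq)`, and `g` odd ⟺ `#(2Cl ∩ Cl[2]) = 1` (Cauchy). No `hR`.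
[cite: Cox2013, §3.B Prop. 3.11, Thm. 3.15] [cite: Stevenhagen1995RedeiMatrices, §2 Thm. 1 (l = 2)]
[cite: TianYuanZhang2017, §1 (p0002 L78–L82: g(d) = #2Cl(ℚ(√−d)))] -/
theorem odd_gK_two_mul_five_mul {p q : ℕ} (hp : p.Prime) (hq : q.Prime) (hp5 : p % 8 = 5) (hq4 : q % 4 = 3)
    (hpq : jacobiSym p q = -1 ∨ q % 8 = 3) : Odd (gK (2 * (p * q))) :=
  (odd_genusClassNumber_iff _).mpr
    (fourTwoCard_classGroup_eq_one_of_sqrt_neg_two_mul_primes hp hq hp5 hq4 hpq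
      (isQuadraticFieldOfSqrt_genusField (by have := Nat.mul_pos hp.pos hq.pos; omega)))

/-- **`g(2pq)` is ODD on all of `𝒮⁻`** (`(p/q) = −1`, both residues `q ≡ 3, 7 (mod 8)`) — PROOF-B Lemma 2 / Lemma R
as a kernel theorem, in the currency `genusClassNumber (GenusField (2pq))` of the hook; replaces
`odd_genusClassNumber_genusField_two_mul_five_mul_of_jacobiSym_neg (hR)`. [cite: Cox2013, §3.B Thm. 3.15]
[cite: TianYuanZhang2017, §1 (p0002 L78–L82)] -/
theorem odd_gK_two_mul_five_mul_of_jacobiSym_neg {p q : ℕ} (hp : p.Prime) (hq : q.Prime) (hp5 : p % 8 = 5)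
    (hq4 : q % 4 = 3) (hj : jacobiSym p q = -1) : Odd (genusClassNumber (GenusField (2 * (p * q)))) :=
  odd_gK_two_mul_five_mul hp hq hp5 hq4 (Or.inl hj)

/-- **`g(2pq)` is ODD for `q ≡ 3 (mod 8)`, EITHER symbol `(p/q)`** (PROOF-B §10: the rows of `𝒮⁺ ∩ {q ≡ 3 (8)}`
are `θ`-decidable too). [cite: Cox2013, §3.B Thm. 3.15] [cite: TianYuanZhang2017, §1 (p0002 L78–L82)] -/
theorem odd_gK_two_mul_five_mul_of_three_mod_eight {p q : ℕ} (hp : p.Prime) (hq : q.Prime) (hp5 : p % 8 = 5)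
    (hq3 : q % 8 = 3) : Odd (genusClassNumber (GenusField (2 * (p * q)))) :=
  odd_gK_two_mul_five_mul hp hq hp5 (by omega) (Or.inr hq3)

/-! ## §2 Route B's `𝒮⁻` doors without the Rédei–Reichardt binder -/

/-- **Clause (a) on `𝒮⁻` from the `θ`-display ALONE: `ord_{s=1} L(E_{2pq}, s) = 1`** for all primes
`p ≡ 5 (mod 8)`, `q ≡ 3 (mod 4)`, `(p/q) = −1` — `𝓛(N) ≠ 0` by the `θ`-descent (`analyticRank_eq_one_of_thetaSpec`)
with `g(2pq)` odd now a kernel theorem (§1). ONE named input; no Rédei–Reichardt, no GZK, no Selmer count,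
no Monsky 1990. CONDITIONAL on `hΘ`; nothing asserted. [cite: TianYuanZhang2017, §1 (definition of 𝓛(n), p0002 L46–L75), Thm. 3.5] -/
theorem analyticRank_eq_one_sMinus_of_thetaDisplay
    (hΘ : ∀ p q : ℕ, p.Prime → q.Prime → p % 8 = 5 → q % 4 = 3 → thetaGenusPointDatum p q)
    {p q : ℕ} (hp : p.Prime) (hq : q.Prime) (hp5 : p % 8 = 5) (hq4 : q % 4 = 3) (hj : jacobiSym p q = -1) :
    (congruentNumberCurve (2 * (p * q))).analyticRank = 1 := by
  obtain ⟨D, hD, θ, hθ⟩ := hΘ p q hp hq hp5 hq4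
  exact analyticRank_eq_one_of_thetaSpec hp hq hp5 hq4 D hD θ hθ
    (odd_gK_two_mul_five_mul_of_jacobiSym_neg hp hq hp5 hq4 hj)

/-- **Clause (a) for `q ≡ 3 (mod 8)`, either symbol, from the `θ`-display alone** (PROOF-B §10 rows).
CONDITIONAL on `hΘ`; nothing asserted. [cite: TianYuanZhang2017, §1 (definition of 𝓛(n), p0002 L46–L75), Thm. 3.5] -/
theorem analyticRank_eq_one_three_mod_eight_of_thetaDisplay
    (hΘ : ∀ p q : ℕ, p.Prime → q.Prime → p % 8 = 5 → q % 4 = 3 → thetaGenusPointDatum p q)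
    {p q : ℕ} (hp : p.Prime) (hq : q.Prime) (hp5 : p % 8 = 5) (hq3 : q % 8 = 3) :
    (congruentNumberCurve (2 * (p * q))).analyticRank = 1 := by
  obtain ⟨D, hD, θ, hθ⟩ := hΘ p q hp hq hp5 (by omega)
  exact analyticRank_eq_one_of_thetaSpec hp hq hp5 (by omega) D hD θ hθ
    (odd_gK_two_mul_five_mul_of_three_mod_eight hp hq hp5 hq3)

/-- **Route B on `𝒮⁻` with an in-house `2`-Selmer bound ⟹ «`𝓛(2pq)` odd»** (`∃ L` odd, `IsScriptL (2pq) L`) from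
{display, `hSel`} — no Rédei–Reichardt, no GZK, no Monsky 1990, no `hMe`. CONDITIONAL; nothing asserted.
[cite: TianYuanZhang2017, Thm. 3.5 and §3] [cite: SilvermanAEC2009, Thm. X.4.2] -/
theorem odd_scriptL_sMinus_of_thetaDisplay_of_selmer_le_eight
    (hΘ : ∀ p q : ℕ, p.Prime → q.Prime → p % 8 = 5 → q % 4 = 3 → thetaGenusPointDatum p q)
    (hSel : ∀ p q : ℕ, p.Prime → q.Prime → p % 8 = 5 → q % 4 = 3 → jacobiSym p q = -1 →
      Nat.card ((congruentNumberCurve (2 * (p * q))).selmerGroup 2) ≤ 8) :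
    ∀ p q : ℕ, p.Prime → q.Prime → p % 8 = 5 → q % 4 = 3 → jacobiSym p q = -1 →
      ∃ L : ℤ, Odd L ∧ IsScriptL (2 * (p * q)) L := by
  intro p q hp hq hp5 hq4 hj
  obtain ⟨D, hD, θ, hθ⟩ := hΘ p q hp hq hp5 hq4
  have hN0 : 2 * (p * q) ≠ 0 := Nat.mul_ne_zero two_ne_zero (Nat.mul_ne_zero hp.ne_zero hq.ne_zero)
  have hn1 : 1 < 2 * (p * q) := by
    have := Nat.mul_pos hp.pos hq.pos; omega
  refine ⟨D.scriptL (2 * (p * q)), odd_scriptL_of_thetaSpec_of_card_selmerGroup_two_le_eight hp hq hp5 hq4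
    D hD θ hθ (odd_gK_two_mul_five_mul_of_jacobiSym_neg hp hq hp5 hq4 hj) (hSel p q hp hq hp5 hq4 hj), ?_⟩
  exact hD.1 _ (Nat.mem_divisors_self _ hN0) hn1

/-- **Route B ⟹ C-P2-1, sharper (`Ш_an`-unit) form, from {display, `hSel`}** — no Rédei–Reichardt, no GZK, no
Monsky 1990. CONDITIONAL; nothing asserted. [cite: TianYuanZhang2017, §1 ((1.1)), Thm. 3.5]
[cite: Miller2011LMS, Def. 1.1 (arXiv:1010.2431 p. 3)] -/
theorem congruentSilentEvenFiveOrdTwo_of_thetaDisplay_of_selmer_le_eight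
    (hΘ : ∀ p q : ℕ, p.Prime → q.Prime → p % 8 = 5 → q % 4 = 3 → thetaGenusPointDatum p q)
    (hSel : ∀ p q : ℕ, p.Prime → q.Prime → p % 8 = 5 → q % 4 = 3 → jacobiSym p q = -1 →
      Nat.card ((congruentNumberCurve (2 * (p * q))).selmerGroup 2) ≤ 8) :
    CongruentSilentEvenFiveOrdTwo :=
  congruentSilentEvenFiveOrdTwo_of_odd_scriptL (odd_scriptL_sMinus_of_thetaDisplay_of_selmer_le_eight hΘ hSel)

/-- **Route B ⟹ C-P2-1, OBSERVABLE form (`ord_{s=1} L(E_{2pq}, s) = 1 ∧ BSD(E_{2pq}, 2)` on all of `𝒮⁻`) from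
{display, `hSel`}** — no Rédei–Reichardt, no GZK, no Monsky 1990: per member, rank `1` and `Ш[2^∞] = 0`
(`rank_eq_one_sha_odd_scriptL_of_thetaSpec_of_le_eight`) and the fact-free door D-CN-5. CONDITIONAL; nothing
asserted. [cite: Miller2011LMS, Def. 1.1 (arXiv:1010.2431 p. 3)] [cite: SilvermanAEC2009, Thm. X.4.2]
[cite: KoblitzECMF1993, Ch. II §5, Theorem (p. 84)] -/
theorem congruentSilentEvenFiveBSDTwo_of_thetaDisplay_of_selmer_le_eight
    (hΘ : ∀ p q : ℕ, p.Prime → q.Prime → p % 8 = 5 → q % 4 = 3 → thetaGenusPointDatum p q)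
    (hSel : ∀ p q : ℕ, p.Prime → q.Prime → p % 8 = 5 → q % 4 = 3 → jacobiSym p q = -1 →
      Nat.card ((congruentNumberCurve (2 * (p * q))).selmerGroup 2) ≤ 8) :
    CongruentSilentEvenFiveBSDTwo := by
  intro p q hp hq hp5 hq4 hj
  obtain ⟨hN, hp2, hq2, hne⟩ := isCor515Family_two_mul_five_mul hp hq hp5 hq4
  haveI : Fact (Nat.Prime 2) := ⟨Nat.prime_two⟩
  obtain ⟨x, hx0, hx, hv⟩ :=
    congruentSilentEvenFiveOrdTwo_of_thetaDisplay_of_selmer_le_eight hΘ hSel p q hp hq hp5 hq4 hj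
  obtain ⟨-, htam⟩ := twoExponent_tamagawa_two_mul_prime_mul hp hq hp2 hq2 hne
  obtain ⟨D, hD, θ, hθ⟩ := hΘ p q hp hq hp5 hq4
  obtain ⟨hr, -, hbot, -⟩ := rank_eq_one_sha_odd_scriptL_of_thetaSpec_of_le_eight hp hq hp5 hq4 D hD θ hθ
    (odd_gK_two_mul_five_mul_of_jacobiSym_neg hp hq hp5 hq4 hj) (hSel p q hp hq hp5 hq4 hj)
  obtain ⟨hr1, hiff⟩ := bsdp_two_congruentNumberCurve_iff_of_rank_one_of_sha_two_eq_bot hN hr hbot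
    (torsionOrder_congruentNumberCurve hN.squarefree) hx0 hx
  refine ⟨hr1, hiff.mpr ?_⟩
  rw [hv, htam, padicValNat.prime_pow]
  norm_num

/-- **«`𝓛(2pq)` odd» on `𝒮⁻` from the display and `hMe`** (Monsky's EVEN matrix counted in the kernel on `𝒮⁻`:
`#Sel₂(E_{2pq}) = 8`) — no Rédei–Reichardt, no GZK, no Monsky 1990: the hypothesis `hB` of the hook's
`congruentSilentEvenFiveOrdTwo_of_odd_scriptL`. CONDITIONAL; nothing asserted. [cite: TianYuanZhang2017, Thm. 3.5 and §3]
[cite: HeathBrown1994SelmerCongruentII, §1 (typescript p. 1 L14–L20), Appendix (Monsky) p. 41 L20–L36] -/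
theorem odd_scriptL_sMinus_of_thetaDisplay_of_monskyEven
    (hΘ : ∀ p q : ℕ, p.Prime → q.Prime → p % 8 = 5 → q % 4 = 3 → thetaGenusPointDatum p q)
    (hMe : monsky_card_selmerGroup_two_even) :
    ∀ p q : ℕ, p.Prime → q.Prime → p % 8 = 5 → q % 4 = 3 → jacobiSym p q = -1 →
      ∃ L : ℤ, Odd L ∧ IsScriptL (2 * (p * q)) L :=
  odd_scriptL_sMinus_of_thetaDisplay_of_selmer_le_eight hΘ
    (fun _ _ hp hq hp5 hq4 hj => (card_selmerGroup_two_two_mul_five_mul hMe hp hq hp5 hq4 hj).le)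

/-- **Route B ⟹ C-P2-1, sharper (`Ш_an`-unit) form, from {display, `hMe`}** — no Rédei–Reichardt, no GZK, no
Monsky 1990. CONDITIONAL; nothing asserted. [cite: TianYuanZhang2017, §1 ((1.1)), Thm. 3.5]
[cite: HeathBrown1994SelmerCongruentII, Appendix (Monsky) p. 41 L20–L36] [cite: Miller2011LMS, Def. 1.1 (arXiv:1010.2431 p. 3)] -/
theorem congruentSilentEvenFiveOrdTwo_of_thetaDisplay_of_monskyEven
    (hΘ : ∀ p q : ℕ, p.Prime → q.Prime → p % 8 = 5 → q % 4 = 3 → thetaGenusPointDatum p q)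
    (hMe : monsky_card_selmerGroup_two_even) : CongruentSilentEvenFiveOrdTwo :=
  congruentSilentEvenFiveOrdTwo_of_odd_scriptL (odd_scriptL_sMinus_of_thetaDisplay_of_monskyEven hΘ hMe)

/-- **Route B ⟹ C-P2-1, OBSERVABLE form (`ord_{s=1} L(E_{2pq}, s) = 1 ∧ BSD(E_{2pq}, 2)` on all of `𝒮⁻`) from TWO
named inputs {`thetaGenusPointDatum`, `hMe`}** — NO Rédei–Reichardt, NO GZK, NO Monsky 1990: the sharper form
through prover-A's door `congruentSilentEvenFiveBSDTwo_of_ordTwo_of_monskyEven`, its per-member rank-one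
hypothesis discharged by the Rank file's §5 (rank `≥ 1` from the genus point, `≤ 1` from `#Sel₂ = 8`). The cheapest
fact set of route B's kernel enclosure: the display (reduced to `thetaCMDatum`, (D1)–(D7)) and the `2`-Selmer
count. CONDITIONAL; nothing asserted. [cite: HeathBrown1994SelmerCongruentII, Appendix (Monsky) p. 41 L20–L36]
[cite: TianYuanZhang2017, Thm. 3.5 and §1 (1.1)] [cite: Miller2011LMS, Def. 1.1 (arXiv:1010.2431 p. 3)] -/
theorem congruentSilentEvenFiveBSDTwo_of_thetaDisplay_of_monskyEven
    (hΘ : ∀ p q : ℕ, p.Prime → q.Prime → p % 8 = 5 → q % 4 = 3 → thetaGenusPointDatum p q)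
    (hMe : monsky_card_selmerGroup_two_even) : CongruentSilentEvenFiveBSDTwo := by
  refine congruentSilentEvenFiveBSDTwo_of_ordTwo_of_monskyEven hMe (fun p q hp hq hp5 hq4 hj => ?_)
    (congruentSilentEvenFiveOrdTwo_of_thetaDisplay_of_monskyEven hΘ hMe)
  obtain ⟨D, hD, θ, hθ⟩ := hΘ p q hp hq hp5 hq4
  exact (rank_eq_one_sha_odd_scriptL_of_thetaSpec_of_le_eight hp hq hp5 hq4 D hD θ hθ
    (odd_gK_two_mul_five_mul_of_jacobiSym_neg hp hq hp5 hq4 hj)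
    (card_selmerGroup_two_two_mul_five_mul hMe hp hq hp5 hq4 hj).le).1

/-- **Route B ⟹ C-P2-1 observable form from {`thetaCMDatum` (D1)–(D7), `hMe`}** — the display pushed down to the
CM points (`thetaGenusPointDatum_of_thetaCMDatum`); the form quoted in the cell's fact-set tables. CONDITIONAL;
nothing asserted. [cite: TianYuanZhang2017, Prop. 3.2 (2), Thm. 3.6 (1)(2), Lemma 3.18, Thm. 3.5]
[cite: HeathBrown1994SelmerCongruentII, Appendix (Monsky) p. 41 L20–L36] -/
theorem congruentSilentEvenFiveBSDTwo_of_thetaCMDatum_of_monskyEven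
    (hΘ : ∀ p q : ℕ, p.Prime → q.Prime → p % 8 = 5 → q % 4 = 3 → thetaCMDatum p q)
    (hMe : monsky_card_selmerGroup_two_even) : CongruentSilentEvenFiveBSDTwo :=
  congruentSilentEvenFiveBSDTwo_of_thetaDisplay_of_monskyEven
    (fun p q hp hq hp5 hq4 => thetaGenusPointDatum_of_thetaCMDatum hp hq (hΘ p q hp hq hp5 hq4)) hMe

/-! ## §3 Beyond `𝒮⁻`: every `q ≡ 3 (mod 8)`, EITHER symbol `(p/q)`, from {display, `hMe`} (PROOF-B §10) -/

/-- **Per-pair engine of route B**: for primes `p ≡ 5 (mod 8)`, `q ≡ 3 (mod 4)` with `g(2pq)` odd, the display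
(`D`, `θ`) and a `2`-Selmer bound `#Sel₂(E_{2pq}) ≤ 8`: `ord_{s=1} L(E_{2pq}, s) = 1 ∧ BSD(E_{2pq}, 2)`. Rank `1`,
`Ш[2^∞] = 0`, `𝓛` odd by `rank_eq_one_sha_odd_scriptL_of_thetaSpec_of_le_eight`; `L′(E,1) = 2^{2}·𝓛²·Ω·Reg`
(TYZ (1.1) read in the tree) so `x = 4𝓛²`, `ord₂ x = 2 = ord₂ 2⁶ − 4` (door D-CN-5, fact-free form). The symbol
`(p/q)` does not enter. CONDITIONAL on the display; nothing asserted. [cite: TianYuanZhang2017, §1 ((1.1), p0002 L63–L75), Thm. 3.5]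
[cite: Miller2011LMS, Def. 1.1 (arXiv:1010.2431 p. 3)] [cite: SilvermanAEC2009, Thm. X.4.2]
[cite: KoblitzECMF1993, Ch. II §5, Theorem (p. 84)] -/
theorem analyticRank_eq_one_and_bsdp_two_of_thetaSpec_of_le_eight {p q : ℕ} (hp : p.Prime) (hq : q.Prime)
    (hp5 : p % 8 = 5) (hq4 : q % 4 = 3) (D : GenusPointData (2 * (p * q))) (hD : D.Printed)
    (θ : D.H ≃ₐ[ℚ] D.H) (hθ : thetaSpec D θ) (hg : Odd (gK (2 * (p * q))))
    (hsel : Nat.card ((congruentNumberCurve (2 * (p * q))).selmerGroup 2) ≤ 8) :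
    (congruentNumberCurve (2 * (p * q))).analyticRank = 1 ∧ BSDp (congruentNumberCurve (2 * (p * q))) 2 := by
  obtain ⟨hN, hp2, hq2, hne⟩ := isCor515Family_two_mul_five_mul hp hq hp5 hq4
  haveI := isElliptic_congruentNumberCurve hN.ne_zero
  haveI : Fact (Nat.Prime 2) := ⟨Nat.prime_two⟩
  obtain ⟨hr, -, hbot, hLodd⟩ :=
    rank_eq_one_sha_odd_scriptL_of_thetaSpec_of_le_eight hp hq hp5 hq4 D hD θ hθ hg hsel
  have hn1 : 1 < 2 * (p * q) := by
    have := Nat.mul_pos hp.pos hq.pos; omega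
  have hL : IsScriptL (2 * (p * q)) (D.scriptL (2 * (p * q))) := hD.1 _ (Nat.mem_divisors_self _ hN.ne_zero) hn1
  have hL0' : D.scriptL (2 * (p * q)) ≠ 0 := fun h => by simp [h] at hLodd
  have hL0 : (D.scriptL (2 * (p * q)) : ℚ) ≠ 0 := by exact_mod_cast hL0'
  have hr1 := analyticRank_congruentNumberCurve_eq_one_of_isScriptL hN.squarefree hN.mod_eight hL hL0'
  obtain ⟨he, htam⟩ := twoExponent_tamagawa_two_mul_prime_mul hp hq hp2 hq2 hne
  have hx : deriv (congruentNumberCurve (2 * (p * q))).entireLFunction 1 =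
      (((2 : ℚ) ^ twoExponent (2 * (p * q)) * (D.scriptL (2 * (p * q)) : ℚ) ^ 2 : ℚ) : ℂ) *
        ((congruentNumberCurve (2 * (p * q))).realPeriodRat : ℂ) *
          ((congruentNumberCurve (2 * (p * q))).regulator : ℂ) := by
    rw [← (leadingLCoeff_eq_deriv_of_analyticRank_eq_one hr1).1,
      leadingLCoeff_congruentNumberCurve_eq_of_isScriptL (Nat.pos_of_ne_zero hN.ne_zero) hr1 hL]
    push_cast
    ring
  obtain ⟨hr1', hiff⟩ := bsdp_two_congruentNumberCurve_iff_of_rank_one_of_sha_two_eq_bot hN hr hbot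
    (torsionOrder_congruentNumberCurve hN.squarefree)
    (mul_ne_zero (zpow_ne_zero _ two_ne_zero) (pow_ne_zero _ hL0)) hx
  refine ⟨hr1', hiff.mpr ?_⟩
  rw [padicValRat_two_zpow_mul_sq hLodd, he, htam, padicValNat.prime_pow]
  norm_num

/-- **`ord_{s=1} L(E_{2pq}, s) = 1 ∧ BSD(E_{2pq}, 2)` for ALL primes `p ≡ 5 (mod 8)`, `q ≡ 3 (mod 8)` — EITHER
symbol `(p/q)` — from TWO named inputs {display, `hMe`}**: `g(2pq)` odd is unconditional for `q ≡ 3 (mod 8)`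
(§1), `#Sel₂(E_{2pq}) = 8` for every even-five pair (`card_selmerGroup_two_two_mul_five_mul_any (hMe)`), and the
per-pair engine. These are PROOF-B §10's complementary rows `𝒮⁺ ∩ {q ≡ 3 (8)}` (where the landed `𝒮⁺` theorem
needs TYZ Thm 1.2 + GZK + Rédei–Reichardt + Monsky) together with the `q ≡ 3 (8)` half of `𝒮⁻` — here with NO
TYZ Thm 1.2 binder, NO GZK, NO Rédei–Reichardt, NO Monsky 1990. CONDITIONAL on `hΘ`, `hMe`; nothing asserted;
no mark moved. [cite: TianYuanZhang2017, §1 ((1.1)), Thm. 3.5]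
[cite: HeathBrown1994SelmerCongruentII, §1 (typescript p. 1 L14–L20), Appendix (Monsky) p. 41 L20–L36]
[cite: Miller2011LMS, Def. 1.1 (arXiv:1010.2431 p. 3)] -/
theorem analyticRank_eq_one_and_bsdp_two_three_mod_eight_of_thetaDisplay_of_monskyEven
    (hΘ : ∀ p q : ℕ, p.Prime → q.Prime → p % 8 = 5 → q % 4 = 3 → thetaGenusPointDatum p q)
    (hMe : monsky_card_selmerGroup_two_even) {p q : ℕ} (hp : p.Prime) (hq : q.Prime) (hp5 : p % 8 = 5)
    (hq3 : q % 8 = 3) :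
    (congruentNumberCurve (2 * (p * q))).analyticRank = 1 ∧ BSDp (congruentNumberCurve (2 * (p * q))) 2 := by
  have hq4 : q % 4 = 3 := by omega
  obtain ⟨D, hD, θ, hθ⟩ := hΘ p q hp hq hp5 hq4
  exact analyticRank_eq_one_and_bsdp_two_of_thetaSpec_of_le_eight hp hq hp5 hq4 D hD θ hθ
    (odd_gK_two_mul_five_mul_of_three_mod_eight hp hq hp5 hq3)
    (card_selmerGroup_two_two_mul_five_mul_any hMe hp hq hp5 hq4).le

/-- **The same rows with an in-house `2`-Selmer bound** (`hSel₃` : `#Sel₂(E_{2pq}) ≤ 8` for `p ≡ 5 (mod 8)`,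
`q ≡ 3 (mod 8)`; in print Lagrange 1975 §11 / Aoki 1999 Thm. 2.1) instead of `hMe`. CONDITIONAL; nothing asserted.
[cite: TianYuanZhang2017, §1 ((1.1)), Thm. 3.5] [cite: SilvermanAEC2009, Thm. X.4.2] -/
theorem analyticRank_eq_one_and_bsdp_two_three_mod_eight_of_thetaDisplay_of_selmer_le_eight
    (hΘ : ∀ p q : ℕ, p.Prime → q.Prime → p % 8 = 5 → q % 4 = 3 → thetaGenusPointDatum p q)
    (hSel₃ : ∀ p q : ℕ, p.Prime → q.Prime → p % 8 = 5 → q % 8 = 3 →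
      Nat.card ((congruentNumberCurve (2 * (p * q))).selmerGroup 2) ≤ 8)
    {p q : ℕ} (hp : p.Prime) (hq : q.Prime) (hp5 : p % 8 = 5) (hq3 : q % 8 = 3) :
    (congruentNumberCurve (2 * (p * q))).analyticRank = 1 ∧ BSDp (congruentNumberCurve (2 * (p * q))) 2 := by
  have hq4 : q % 4 = 3 := by omega
  obtain ⟨D, hD, θ, hθ⟩ := hΘ p q hp hq hp5 hq4
  exact analyticRank_eq_one_and_bsdp_two_of_thetaSpec_of_le_eight hp hq hp5 hq4 D hD θ hθ
    (odd_gK_two_mul_five_mul_of_three_mod_eight hp hq hp5 hq3) (hSel₃ p q hp hq hp5 hq3)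

end Summit.BirchSwinnertonDyer.Rank1Residual.P2

end
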